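import Summits.ResolutionOfSingularities.ResolutionOfSingularities.Theorems.PurelyInseparableDim4ScopeTrapLocal
import Summits.ResolutionOfSingularities.ResolutionOfSingularities.Theorems.PurelyInseparableDim4ScopeLocalGame
import Summits.ResolutionOfSingularities.ResolutionOfSingularities.Theorems.PurelyInseparableDim4ScopeBaseChange
import HarnessLib

/-!
# [OURS · res-dim4-pi · F4-C-loc] The LOCAL kill format meets the typed local game: a passing `localTrapB` table over one
  field of characteristic `p` refutes `TerminatesInScopeLoc p q`; and local traps go UP along field extensions

Cell `res-dim4-pi` (D-0157 DOOR 2, wave 2), seat `res-dim4-p-6` g2; two-lemma glue between res-dim4-p-8 g2's LOCAL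
kill-certificate format (`LoopC.localTrapB`, p665021 — written over the seat's `RSucc q localB` before the local game was
typed) and the typed proposition `TerminatesInScopeLoc` (`…ScopeLocalGame`, p667415):

* **`not_terminatesInScopeLoc_of_localTrapB`**: `localTrapB q T = true`, `T ≠ []`, over a field of characteristic `p` ⇒
  `¬ TerminatesInScopeLoc p q` (the F4-C-loc ∃-form dies by DATA + one `decide`, exactly as F4-C-glob dies by
  `scopeTrapB`); p-8's `not_terminatesInScope_of_localTrapB` is the weaker GLOBAL consequence.
* **`rSucc_local_map`**, **`localTrapSet_image`**: a local reply / a trap of the local in-scope game over `k` goes UP to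
  any field extension `f : k →+* K` (rational replies stay rational, the scope goes up by
  `ScopeBaseChange.inCoordinateScope_map`) — so a local trap found over `𝔽_p` kills F4-C-loc over EVERY field of
  characteristic `p`, state-wise: **`not_rWins_local_map_of_localTrap`**.

Scope (honest): frame bookkeeping; no new specimen; F4-C-loc(3,3) ∃-form stays OPEN (no local trap against ALL centres is
known — every located hop region is no local play, `LoopCLocal.hopSpecimens_localWins`).  [OURS · counted 0 · elementary;
AI kernel work, weaker than expert review.]  NOTHING here is a statement about resolution of singularities; resolution in
dimension `≥ 4` / characteristic `p > 0` is NOT proved by anything in this file.  bears_on: LADDER-RESOLUTION:D157-DOOR2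
(res-dim4-pi · F4-C-loc kill shape).  Host item (DR-157-C): `stmt-ResolutionOfSingularities-16155`, helper.
-/

set_option linter.dupNamespace false -- mandated namespace of this single-conjunct summit

noncomputable section

open MvPolynomial Finset

namespace Summit.ResolutionOfSingularities.ResolutionOfSingularities.Theorems.PIDim4

namespace LoopCLocal

open Literature.AlgebraicGeometry.Resolution
open Literature.AlgebraicGeometry.Resolution.CentreBlowup
open StepKit LoopC

/-! ## §1 The local kill format refutes the typed local proposition -/

/-- **A passing LOCAL trap table over one field of characteristic `p` refutes F4-C-loc** (`TerminatesInScopeLoc p q`).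
OURS. [folklore] -/
theorem not_terminatesInScopeLoc_of_localTrapB (p q : ℕ) {K : Type} [Field K] [CharP K p] [DecidableEq K]
    {T : ScopeTrapRows K} (h : localTrapB q T = true) (hne : T ≠ []) : ¬ TerminatesInScopeLoc p q :=
  not_terminatesInScopeLoc_of_localTrap (trapSet_rowsOf_nonempty hne) (isTrapSet_of_localTrapB h)

/-! ## §2 Local replies and local traps go up along field extensions -/

section Up

variable {k K : Type} [Field k] [Field K] [DecidableEq k] [DecidableEq K] (f : k →+* K)

/-- **Local replies go up**: a LOCAL reply over `k` (point `b`, `bᵢ = 0` off the centre) is a local reply over `K`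
between the base-changed states, at the rational point `f ∘ b`. OURS. [folklore] -/
theorem rSucc_local_map {q : ℕ} {S : Finset (Fin 4)} {s s' : State k} (h : RSucc q localB s S s') :
    RSucc q localB (⟨MvPolynomial.map f s.F, s.r, s.exc⟩ : State K) S ⟨MvPolynomial.map f s'.F, s'.r, s'.exc⟩ := by
  obtain ⟨j, b, hj, hbj, hloc, heq, hne, rfl⟩ := h
  have hb := (localB_eq_true_iff S j b).mp hloc
  refine ⟨j, f ∘ b, hj, by simp [hbj], (localB_eq_true_iff S j _).mpr fun i hi => by simp [hb i hi],
    (BaseChange.isEquimultiplePoint_map_ringHom_iff f q S j b s).mpr heq, ?_, ?_⟩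
  · rw [BaseChange.step_map f q S j b s]
    show MvPolynomial.map f (CentreBlowup.step q S j b s).F ≠ 0
    exact fun h0 => hne (MvPolynomial.map_injective f f.injective (by rw [h0, map_zero]))
  · rw [BaseChange.step_map f q S j b s]

/-- **Local traps go up**: the image of a trap of the local in-scope game over `k` is a trap of the local in-scope
game over `K` (permissibility is invariant, the scope goes up, the recorded local replies stay legal). OURS. [folklore] -/
theorem localTrapSet_image {q : ℕ} {T : Set (State k)}
    (hT : Game.IsTrapSet
      (fun (t : State k) (S : Finset (Fin 4)) => InCoordinateScope q t.F ∧ IsPermissibleCentre q S t.F)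
      (RSucc q localB) T) :
    Game.IsTrapSet
      (fun (t : State K) (S : Finset (Fin 4)) => InCoordinateScope q t.F ∧ IsPermissibleCentre q S t.F)
      (RSucc q localB)
      ((fun s : State k => (⟨MvPolynomial.map f s.F, s.r, s.exc⟩ : State K)) '' T) := by
  rintro _ ⟨s, hs, rfl⟩
  obtain ⟨⟨S₀, hsc₀, hS₀⟩, hall⟩ := hT s hs
  refine ⟨⟨S₀, ScopeBaseChange.inCoordinateScope_map f hsc₀,
    (BaseChange.isPermissibleCentre_map_iff f q S₀ s.F).mpr hS₀⟩, ?_⟩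
  rintro S ⟨-, hS⟩
  obtain ⟨s', hs', hsucc⟩ := hall S ⟨hsc₀, (BaseChange.isPermissibleCentre_map_iff f q S s.F).mp hS⟩
  exact ⟨_, ⟨s', hs', rfl⟩, rSucc_local_map f hsucc⟩

/-- **A local trap over `k` kills the local wins over every extension `K`**: no base-changed trap state is in A's
attractor `RWins q localB` over `K`. OURS. [folklore] -/
theorem not_rWins_local_map_of_localTrap {q : ℕ} {T : Set (State k)}
    (hT : Game.IsTrapSet
      (fun (t : State k) (S : Finset (Fin 4)) => InCoordinateScope q t.F ∧ IsPermissibleCentre q S t.F)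
      (RSucc q localB) T) {s : State k} (hs : s ∈ T) :
    ¬ RWins q localB (⟨MvPolynomial.map f s.F, s.r, s.exc⟩ : State K) :=
  fun hw => Game.Wins.not_mem_of_isTrapSet _ _ (localTrapSet_image f hT) hw ⟨s, hs, rfl⟩

end Up

/-- Prime-field form: a passing LOCAL trap table over `𝔽_p` refutes the ∀-state clause of F4-C-loc over EVERY field of
characteristic `p` at the base-changed trap states. OURS. [folklore] -/
theorem not_rWins_local_of_localTrapB_zmod (p q : ℕ) [Fact p.Prime] {T : ScopeTrapRows (ZMod p)}
    (h : localTrapB q T = true) (K : Type) [Field K] [CharP K p] [DecidableEq K] :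
    ∀ s ∈ trapSet (rowsOf T),
      ¬ RWins q localB (⟨MvPolynomial.map (ZMod.castHom (dvd_refl p) K) s.F, s.r, s.exc⟩ : State K) :=
  fun _ hs => not_rWins_local_map_of_localTrap (ZMod.castHom (dvd_refl p) K) (isTrapSet_of_localTrapB h) hs

end LoopCLocal

end Summit.ResolutionOfSingularities.ResolutionOfSingularities.Theorems.PIDim4

end
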